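import Literature.NumberTheory.LFunctions.DworkRationalityFredholmTrace
import Literature.NumberTheory.LFunctions.DworkRationalityFredholmLeibniz
import Literature.NumberTheory.LFunctions.DworkRationalityExpCoeffContinuity
import Literature.NumberTheory.LFunctions.DworkRationalityMeromorphyAssembly
import HarnessLib

/-!
# Dwork's Fredholm determinant is entire: proof of `dworkFredholmMatrix` (Koblitz, Ch. V §3, Lemma 4)

Part of the bottom-up proof of Dwork's rationality theorem
(`Literature/NumberTheory/LFunctions/DworkRationality.lean`). This file **discharges** the named
fact `Literature.NumberTheory.LFunctions.Dwork.dworkFredholmMatrix`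
(`…/DworkRationalityFredholm.lean`; Koblitz, GTM 58, Ch. V §3, Lemma 4 together with the
operator-theoretic half of Lemma 3): `Literature.NumberTheory.LFunctions.Dwork.dworkFredholmMatrix_holds`,
and consequently the fact `Dwork.dworkFredholm` of `…/DworkRationalityMeromorphy.lean`
(`Literature.NumberTheory.LFunctions.Dwork.dworkFredholm_holds`). With the accepted assemblies,
Dwork's rationality theorem `Literature.NumberTheory.LFunctions.exists_polynomial_mul_zetaSeries_eq`
is thereby reduced to the two named facts `Dwork.dworkLifting` (Koblitz V.2/V.4) and
`Dwork.pointCount_eq_sum_systemCount` (scheme-theoretic reduction):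
`Literature.NumberTheory.LFunctions.Dwork.exists_polynomial_mul_zetaSeries_eq_of_lifting`.

## Proof (Koblitz, Ch. V §3, pp. 130–131, with the infinite-matrix extension of §4 Ex. 8)

Let `G ∈ R₀` (`‖g_w‖ ≤ ρ^{|w|}`; we may take `0 < ρ < 1`), `q ≥ 2`, `A = (g_{qv-u})`, and
`Δ := exp(-∑_{s≥1} Tr(Aˢ)Tˢ/s)` (`Dwork.fredholmDet`), so that `Δ(0) = 1` and
`Δ · exp(∑ Tr(Aˢ)Tˢ/s) = 1` are automatic; it remains to see that `Δ` is `p`-adic entire.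
For the finite truncations `A_N` (`Dwork.truncMatrix`), `det(1 - TA_N) = exp(-∑ Tr(A_Nˢ)Tˢ/s)`
(`charpolyRev_eq_exp_subst_neg`) and `Tr(A_Nˢ) → Tr(Aˢ)` (`tendsto_trace_truncMatrix_pow`), so
`[Tᵐ] det(1 - TA_N) → [Tᵐ] Δ` (`tendsto_coeff_exp_subst`). By the Leibniz bound
(`norm_coeff_charpolyRev_le`) `‖[Tᵐ] det(1 - TA_N)‖ ≤ ρ^{(q-1)μ}` whenever every `m`-set of
exponents has total degree `≥ μ`; since only `A(d) = #{u : |u| ≤ d}` exponents have degree `≤ d`,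
`μ = (m - A(d))(d+1)` works for every `d` (`sum_degree_ge`), uniformly in `N`, hence in the limit
`‖[Tᵐ] Δ‖ ≤ ρ^{(q-1)(m-A(d))(d+1)}` (`norm_coeff_fredholmDet_le`). Given `r > 0` choose `d` with
`ρ^{(q-1)(d+1)} r ≤ 1/2`; then `‖[Tᵐ]Δ‖ rᵐ ≤ r^{A(d)} 2^{-(m-A(d))} → 0` (`isEntire_fredholmDet`),
which is Koblitz's "`(1/m) ord_p b_m → ∞`".

## References

* N. Koblitz, *p-adic Numbers, p-adic Analysis, and Zeta-Functions*, 2nd ed., GTM 58 (1984),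
  Ch. V §3, Lemma 4, pp. 130–131; §4 Ex. 8. [Koblitz1984]
-/

open Filter Finset MvPowerSeries

noncomputable section

namespace Literature.NumberTheory.LFunctions

namespace Dwork

/-! ### Counting exponents of small degree -/

section Counting

variable {ι : Type*} [Finite ι]

/-- `A(d) = #{u : |u| ≤ d}`, the number of exponents of degree at most `d`. [folklore] -/
def countDegLE (ι : Type*) [Finite ι] (d : ℕ) : ℕ :=
  (Finsupp.finite_of_degree_le (σ := ι) d).toFinset.card

/-- **Any `m` distinct exponents have total degree `≥ (m - A(d))(d+1)`**: at most `A(d)` of them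
have degree `≤ d` (Koblitz, Ch. V §3, p. 131: "there are only finitely many `u`'s with a given
`|u|`, [so] the average `|u|` … must approach `∞`"). [cite: Koblitz1984, Ch. V §3] -/
theorem sum_degree_ge (d : ℕ) {N : ℕ} (S : Finset (DegLE ι N)) :
    (S.card - countDegLE ι d) * (d + 1) ≤ ∑ v ∈ S, Finsupp.degree v.1 := by
  classical
  set S₁ := S.filter (fun v => Finsupp.degree v.1 ≤ d) with hS₁
  set S₂ := S.filter (fun v => ¬Finsupp.degree v.1 ≤ d) with hS₂
  have hcard : S₁.card + S₂.card = S.card := Finset.card_filter_add_card_filter_not _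
  have h₁ : S₁.card ≤ countDegLE ι d := by
    rw [countDegLE, ← Finset.card_map ⟨Subtype.val, Subtype.val_injective⟩]
    apply Finset.card_le_card
    intro u hu
    rw [Finset.mem_map] at hu
    obtain ⟨v, hv, rfl⟩ := hu
    rw [hS₁, mem_filter] at hv
    rw [Set.Finite.mem_toFinset, Set.mem_setOf_eq]
    exact hv.2
  calc (S.card - countDegLE ι d) * (d + 1) ≤ S₂.card * (d + 1) := by
        apply Nat.mul_le_mul_right; omega
    _ = S₂.card • (d + 1) := (smul_eq_mul _ _).symm
    _ ≤ ∑ v ∈ S₂, Finsupp.degree v.1 := Finset.card_nsmul_le_sum _ _ _ fun v hv => by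
        rw [hS₂, mem_filter, not_le] at hv; exact hv.2
    _ ≤ ∑ v ∈ S, Finsupp.degree v.1 :=
        Finset.sum_le_sum_of_subset (filter_subset _ _)

end Counting

/-! ### The Fredholm determinant and its coefficients as limits -/

section Limit

variable {p : ℕ} [Fact p.Prime] {ι : Type*} [Fintype ι]

/-- **Dwork's Fredholm determinant** `Δ(T) = det(1 - AT)`, *defined* as
`exp(-∑_{s≥1} Tr(Ψˢ)Tˢ/s)` with `Tr(Ψˢ)` in coefficient form (`Dwork.coeffTraceLogSeries`);
Koblitz's Lemma 4 (Ch. V §3, p. 131) identifies the two, and with this definition the content of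
the lemma is that `Δ` is entire (`isEntire_fredholmDet`). [cite: Koblitz1984, Ch. V §3 Lemma 4] -/
def fredholmDet (p : ℕ) [Fact p.Prime] (q : ℕ) (hq : q ≠ 0) (G : MvPowerSeries ι ℂ_[p]) :
    PowerSeries ℂ_[p] :=
  (PowerSeries.exp ℂ_[p]).subst (-coeffTraceLogSeries p q hq G)

omit [Fintype ι] in
/-- `∑ c_s Tˢ/s` has no constant term. [folklore] -/
theorem constantCoeff_coeffTraceLogSeries (q : ℕ) (hq : q ≠ 0) (G : MvPowerSeries ι ℂ_[p]) :
    PowerSeries.constantCoeff (coeffTraceLogSeries p q hq G) = 0 := by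
  rw [← PowerSeries.coeff_zero_eq_constantCoeff_apply, coeffTraceLogSeries, PowerSeries.coeff_mk,
    if_pos rfl]

variable {G : MvPowerSeries ι ℂ_[p]} {ρ : ℝ} (hρ0 : 0 ≤ ρ) (hρ1 : ρ < 1)
  (hG : ∀ w : ι →₀ ℕ, ‖coeff w G‖ ≤ ρ ^ Finsupp.degree w)

include hρ0 hρ1 hG in
open Classical in
/-- **`[Tᵐ] det(1 - TA_N) → [Tᵐ] Δ`** as `N → ∞` (`q ≥ 2`): `det(1 - TA_N) = exp(-∑ Tr(A_Nˢ)Tˢ/s)`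
for the finite matrices, `Tr(A_Nˢ) → Tr(Aˢ)`, and `[Tᵐ] exp(L)` depends continuously on
`[T¹]L, …, [Tᵐ]L` (Koblitz, Ch. V §3 Lemma 4 and §4 Ex. 8). [cite: Koblitz1984, Ch. V §3 Lemma 4] -/
theorem tendsto_coeff_charpolyRev_truncMatrix {q : ℕ} (hq : 2 ≤ q) (m : ℕ) :
    Tendsto (fun N => ((truncMatrix N q G).charpolyRev).coeff m) atTop
      (nhds (PowerSeries.coeff m (fredholmDet p q (by omega) G))) := by
  have hcoe : ∀ N, ((truncMatrix N q G).charpolyRev).coeff m =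
      PowerSeries.coeff m ((PowerSeries.exp ℂ_[p]).subst
        (-matrixTraceLogSeries (truncMatrix N q G))) := fun N => by
    rw [← Polynomial.coeff_coe, charpolyRev_eq_exp_subst_neg]
  simp_rw [hcoe]
  refine tendsto_coeff_exp_subst (fun N => by rw [map_neg, constantCoeff_matrixTraceLogSeries, neg_zero])
    (by rw [map_neg, constantCoeff_coeffTraceLogSeries, neg_zero]) fun j _ => ?_
  simp_rw [map_neg]
  refine Tendsto.neg ?_
  rw [coeffTraceLogSeries, PowerSeries.coeff_mk]
  simp_rw [matrixTraceLogSeries, PowerSeries.coeff_mk]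
  by_cases hj : j = 0
  · subst hj
    simp only [Nat.cast_zero, inv_zero, zero_smul, if_true]
    exact tendsto_const_nhds
  · rw [if_neg hj]
    simp_rw [Algebra.smul_def, map_inv₀, map_natCast]
    exact (tendsto_trace_truncMatrix_pow hρ0 hρ1 hG hq (Nat.pos_of_ne_zero hj)).const_mul _

include hρ0 hG in
open Classical in
/-- **Uniform Leibniz bound for the truncations**: `‖[Tᵐ] det(1 - TA_N)‖ ≤ ρ^{(q-1)(m-A(d))(d+1)}`
for all `N` and `d` (`norm_coeff_charpolyRev_le` with the degree weights and `sum_degree_ge`). [cite: Koblitz1984, Ch. V §3] -/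
theorem norm_coeff_charpolyRev_truncMatrix_le (hρ1' : ρ ≤ 1) (q N m d : ℕ) :
    ‖((truncMatrix N q G).charpolyRev).coeff m‖ ≤
      ρ ^ ((q - 1) * ((m - countDegLE ι d) * (d + 1))) :=
  norm_coeff_charpolyRev_le (truncMatrix N q G) (fun v => Finsupp.degree v.1) hρ0 hρ1' q
    (fun i j => by rw [truncMatrix, Matrix.of_apply]; exact norm_dworkEntry_le hρ0 hG q i.1 j.1)
    fun S hS => by rw [← hS]; exact sum_degree_ge d S

include hρ0 hρ1 hG in
/-- **`‖[Tᵐ] Δ‖ ≤ ρ^{(q-1)(m-A(d))(d+1)}`** for every `d` (limit of the uniform bound). [cite: Koblitz1984, Ch. V §3 Lemma 4] -/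
theorem norm_coeff_fredholmDet_le {q : ℕ} (hq : 2 ≤ q) (m d : ℕ) :
    ‖PowerSeries.coeff m (fredholmDet p q (by omega) G)‖ ≤
      ρ ^ ((q - 1) * ((m - countDegLE ι d) * (d + 1))) := by
  classical
  exact le_of_tendsto' (tendsto_coeff_charpolyRev_truncMatrix hρ0 hρ1 hG hq m).norm fun N =>
    norm_coeff_charpolyRev_truncMatrix_le hρ0 hG hρ1.le q N m d

include hρ0 hρ1 hG in
/-- **`Δ` is `p`-adic entire** (Koblitz, Ch. V §3, Lemma 4: "`det(1 - AT)` … has an infinite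
radius of convergence", via "`(1/m) ord_p b_m → ∞ as m → ∞`"): for `0 < ρ < 1`, `q ≥ 2`. [cite: Koblitz1984, Ch. V §3 Lemma 4] -/
theorem isEntire_fredholmDet (hρpos : 0 < ρ) {q : ℕ} (hq : 2 ≤ q) :
    IsEntire p (fredholmDet p q (by omega) G) := by
  intro r hr
  -- `c = ρ^{q-1} ∈ (0, 1)`; choose `d` with `c^{d+1} r ≤ 1/2`
  set c : ℝ := ρ ^ (q - 1) with hc
  have hc0 : 0 < c := pow_pos hρpos _
  have hc1 : c < 1 := pow_lt_one₀ hρ0 hρ1 (by omega)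
  obtain ⟨n₀, hn₀⟩ := exists_pow_lt_of_lt_one (show 0 < (2 * r)⁻¹ by positivity) hc1
  set d : ℕ := n₀ with hd
  have hcd : c ^ (d + 1) * r ≤ 1 / 2 := by
    have h1 : c ^ (d + 1) ≤ c ^ n₀ := pow_le_pow_of_le_one hc0.le hc1.le (by omega)
    have h2 : c ^ (d + 1) * r ≤ (2 * r)⁻¹ * r := mul_le_mul_of_nonneg_right (h1.trans hn₀.le) hr.le
    rw [mul_inv, inv_mul_cancel_right₀ hr.ne'] at h2
    linarith
  set A := countDegLE ι d with hA
  -- eventual bound `‖e_m‖ rᵐ ≤ r^A (1/2)^{m - A}`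
  refine squeeze_zero_norm' (a := fun m => r ^ A * (1 / 2) ^ (m - A)) ?_ ?_
  · rw [eventually_atTop]
    refine ⟨A, fun m hm => ?_⟩
    rw [Real.norm_eq_abs, abs_of_nonneg (by positivity)]
    have hbound := norm_coeff_fredholmDet_le hρ0 hρ1 hG hq m d
    rw [← hA] at hbound
    calc ‖PowerSeries.coeff m (fredholmDet p q _ G)‖ * r ^ m
        ≤ ρ ^ ((q - 1) * ((m - A) * (d + 1))) * r ^ m :=
          mul_le_mul_of_nonneg_right hbound (pow_nonneg hr.le _)
      _ = (c ^ (d + 1) * r) ^ (m - A) * r ^ A := by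
          rw [hc, ← pow_mul, mul_pow, ← pow_mul, mul_assoc, ← pow_add, Nat.sub_add_cancel hm]
          ring_nf
      _ ≤ (1 / 2) ^ (m - A) * r ^ A :=
          mul_le_mul_of_nonneg_right (pow_le_pow_left₀ (by positivity) hcd _) (pow_nonneg hr.le _)
      _ = r ^ A * (1 / 2) ^ (m - A) := mul_comm _ _
  · have h := (tendsto_pow_atTop_nhds_zero_of_lt_one (show (0 : ℝ) ≤ 1 / 2 by norm_num)
      (show (1 : ℝ) / 2 < 1 by norm_num)).comp (tendsto_sub_atTop_nat A)
    have := h.const_mul (r ^ A)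
    rw [mul_zero] at this
    exact this

end Limit

/-! ### Discharge of `dworkFredholmMatrix` -/

section Holds

/-- **Proof of `dworkFredholmMatrix`** (Koblitz, Ch. V §3, Lemmas 3–4; see the module docstring):
for `G ∈ R₀` and `q ≥ 2`, `Δ = exp(-∑ c_s(G) Tˢ/s)` is `p`-adic entire, has `Δ(0) = 1`, and
`Δ · exp(∑ c_s(G) Tˢ/s) = 1`. [cite: Koblitz1984, Ch. V §3 Lemma 4] -/
theorem dworkFredholmMatrix_holds : dworkFredholmMatrix := by
  intro p _ ι _ q hq G hG
  obtain ⟨ρ₀, hρ₀0, hρ₀1, hG₀⟩ := hG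
  -- enlarge `ρ₀` to `ρ = max ρ₀ (1/2) ∈ (0, 1)`
  set ρ : ℝ := max ρ₀ (1 / 2) with hρ
  have hρpos : 0 < ρ := lt_max_of_lt_right (by norm_num)
  have hρ1 : ρ < 1 := max_lt hρ₀1 (by norm_num)
  have hGρ : ∀ w : ι →₀ ℕ, ‖coeff w G‖ ≤ ρ ^ Finsupp.degree w := fun w =>
    (hG₀ w).trans (pow_le_pow_left₀ hρ₀0 (le_max_left _ _) _)
  have hL0 := constantCoeff_coeffTraceLogSeries (p := p) q (by omega) G
  refine ⟨fredholmDet p q (by omega) G, isEntire_fredholmDet hρpos.le hρ1 hGρ hρpos hq, ?_, ?_⟩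
  · exact Literature.AlgebraicGeometry.Motives.FrobeniusTrace.constantCoeff_exp_subst
      (by rw [map_neg, hL0, neg_zero])
  · rw [fredholmDet, mul_comm]
    exact Literature.AlgebraicGeometry.Motives.FrobeniusTrace.exp_subst_mul_exp_subst_neg hL0

/-- **Discharge of `Dwork.dworkFredholm`** (Koblitz, Ch. V §3, Lemmas 3–4): the matrix form just
proved and the character-sum half of Lemma 3 (`dworkFredholm_of_matrix`). [cite: Koblitz1984, Ch. V §3 Lemmas 3–4] -/
theorem dworkFredholm_holds : dworkFredholm :=
  dworkFredholm_of_matrix dworkFredholmMatrix_holds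

universe u in
/-- **`p`-adic meromorphy of `Z'` from the lifting alone** (Koblitz, Ch. V §4): with the Fredholm
input discharged, `torusZeta_isMeromorphic` only depends on `dworkLifting`. [cite: Koblitz1984, Ch. V §4] -/
theorem torusZeta_isMeromorphic_of_lifting (h : dworkLifting.{u}) : torusZeta_isMeromorphic.{u} :=
  torusZeta_isMeromorphic_of h dworkFredholm_holds

universe u in
/-- **Dwork's rationality theorem from the two remaining named facts** `dworkLifting` (the
`p`-adic lifting of the character sum through Dwork's splitting function, Koblitz V.2/V.4) and
`pointCount_eq_sum_systemCount` (reduction of point counts of finite-type `k`-schemes to affine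
counts). [cite: Dwork1960, Thm. 1] -/
theorem exists_polynomial_mul_zetaSeries_eq_of_lifting {k : Type u} [Field k] [Finite k]
    (h1 : dworkLifting.{u}) (h3 : pointCount_eq_sum_systemCount.{u}) :
    LFunctions.exists_polynomial_mul_zetaSeries_eq (k := k) :=
  exists_polynomial_mul_zetaSeries_eq_of_lifting_of_fredholm h1 dworkFredholm_holds h3

end Holds

end Dwork

end Literature.NumberTheory.LFunctions
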